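import Literature.Probability.LatticeModels.OnsagerToeplitz
import HarnessLib

/-!
# The Onsager–Yang magnetisation: BGJS (3.3) and (3.7) from boundary-condition independence

Topic `Probability/LatticeModels`, namespace `Literature.Probability.LatticeModels`. A short
companion of `OnsagerYang.lean` / `OnsagerYangProofs.lean` / `OnsagerToeplitz.lean` (the
Benettin–Gallavotti–Jona-Lasinio–Stella route to `onsager_yang`, **crit-ising.S16**) concerning the
two named facts of `OnsagerYang.lean` that are still undischarged and are NOT consequences of the
Griffiths inequalities alone:

* `tendsto_torusRowPair_exists` — BGJS §3 b), eq. (3.3): the iterated periodic limits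
  `(σ_{(0,0)}σ_{(k,0)})_p(β) = lim_N lim_M ⟨σ_{(0,0)}σ_{(k,0)}⟩_{p,NM}` exist, `β ≥ 0`;
* `torusRowPairLimit_sandwich` — BGJS eq. (3.7): `⟨σσ⟩^∅ ≤ (σσ)_p ≤ ⟨σσ⟩⁺`, `β ≥ 0`.

G. Benettin, G. Gallavotti, G. Jona-Lasinio, A. L. Stella, Comm. Math. Phys. **30** (1973) 45–54
("BGJS") print (3.7) under their b) ("follows from the exact solution of the Ising model",
Montroll–Potts–Ward 1963 / Schultz–Mattis–Lieb 1964): (3.7) is (3.6) (GKS in finite volume, a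
theorem: `isingCorr_free_box_le_torusRowPair`, `torusRowPair_le_isingCorr_plus_box`) plus the
EXISTENCE of the limits (3.3). In the tree the inner limits `M → ∞` exist by the transfer matrix
(`IsingTorusTransfer.tendsto_torusRowPair_inner`), the glue "(3.3) ⇒ (3.7)" is proved
(`torusRowPairLimit_sandwich_of_exists`, `torusRowPairLimit_sandwich_at`), and the outer limit
`N → ∞` is the named fact `torusRowPair_tendsto_toeplitzDet` (`OnsagerToeplitz.lean`; Kaufman /
SML diagonalisation, in progress) — which moreover excludes `β ∈ {0, β_c(2)}`. Since
`torusRowPairLimit` is a junk-valued iterated `limUnder`, neither fact is provable without the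
existence of the outer limit.

## What is proved here (sorry-free, no new named fact)

1. **Squeeze** (`tendsto_torusRowPair_outer_of_twoPointFree_eq_twoPointPlus`): at any `β ≥ 0` and
   `k` where the free and plus two-point functions agree, `⟨σ₀σ_{(k,0)}⟩^∅_β = ⟨σ₀σ_{(k,0)}⟩⁺_β`
   (boundary-condition independence, BGJS (3.1)), the outer limit EXISTS and equals the common
   value — (3.6) pins `lim_M ⟨σσ⟩_{p,NM}` between the free and plus box correlations of `B(L)` for
   `N ≥ 2L + 3`, and both box sequences converge to the same number. Hence (3.3) and (3.7) at
   such `(β, k)`, and `(σσ)_p = ⟨σσ⟩⁺` (`torusRowPairLimit_eq_twoPointPlus_of_twoPointFree_eq_twoPointPlus`).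
2. **Boundary-condition independence from the magnetisation** (BGJS §3 c)–d) and (3.10)): if
   `m*(β') = 0` for all `0 ≤ β' ≤ β_c(2)` then `⟨σ₀σ_x⟩^∅_β = ⟨σ₀σ_x⟩⁺_β` for EVERY `β ≥ 0` — below
   and at `β_c(2)` by the Lebowitz–Martin-Löf criterion (`PlusFreeComparison`), above by
   Kramers–Wannier duality (`OnsagerYangProofs`, `β* < β_c(2)`).
3. **Reductions.** Both facts follow from: `onsager_yang` itself
   (`tendsto_torusRowPair_exists_of_onsager_yang`, `torusRowPairLimit_sandwich_of_onsager_yang`,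
   with BGJS (3.1) in full, `twoPointFree_eq_torusRowPairLimit_of_onsager_yang`); `criticalBeta_two`
   together with continuity `m*(β_c(2)) = 0`; the Toeplitz identity `torusRowPair_tendsto_toeplitzDet`
   together with `m*(β_c(2)) = 0` (`…_of_toeplitzDet`: `β = 0` and `β = β_c(2)` by 1.–2., the rest
   by the identity); and the three Toeplitz facts of `OnsagerToeplitz.onsager_yang_of_toeplitz`
   (`…_of_toeplitz`). So the discharge of both facts waits on exactly the same inputs as
   `onsager_yang` (the exact solution), and at `β = β_c(2)` on the continuity of `m*`.

## References

* G. Benettin, G. Gallavotti, G. Jona-Lasinio, A. L. Stella, Comm. Math. Phys. 30 (1973) 45–54,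
  §3 b) eq. (3.3), eqs. (3.1), (3.6), (3.7), (3.10).
* J. L. Lebowitz, A. Martin-Löf, Comm. Math. Phys. 25 (1972) 276–282 (Theorem).
* E. W. Montroll, R. B. Potts, J. C. Ward, J. Math. Phys. 4 (1963) 308–322.
-/

noncomputable section

open Filter Topology

namespace Literature.Probability.LatticeModels

open Literature.Probability.Percolation Literature.Analysis.Toeplitz

/-! ### The squeeze: boundary-condition independence gives the outer limit -/

/-- **BGJS (3.3) at one `(β, k)` from boundary-condition independence** (Benettin–Gallavotti–
Jona-Lasinio–Stella, CMP 30 (1973), §3: eq. (3.6) `⟨σ_xσ_y⟩_{a,B(L)} ≤ ⟨σ_xσ_y⟩_{p,NM} ≤ ⟨σ_xσ_y⟩_{+,B(L)}`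
for the torus containing the box, and a)). If `β ≥ 0` and the free and plus two-point functions
agree at `(k, 0)`, then the inner limits `lim_M ⟨σ_{(0,0)}σ_{(k,0)}⟩_{p,NM}` (transfer matrix,
`tendsto_torusRowPair_inner`) converge, as `N → ∞`, to the common value `⟨σ₀σ_{(k,0)}⟩⁺_β`: they are
squeezed between the free and plus correlations of `B(L)`, `N ≥ 2L + 3`, which both tend to it. [cite: BenettinGallavottiJonaLasinioStella1973, §3 b), eqs. (3.3) and (3.6)] -/
theorem tendsto_torusRowPair_outer_of_twoPointFree_eq_twoPointPlus {β : ℝ} (hβ : 0 ≤ β) {k : ℕ}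
    (heq : twoPointFree 2 β ![(k : ℤ), 0] = twoPointPlus 2 β ![(k : ℤ), 0]) :
    Tendsto (fun N : ℕ => limUnder atTop fun M : ℕ => torusRowPair β N M k) atTop
      (𝓝 (twoPointPlus 2 β ![(k : ℤ), 0])) := by
  have hinner : ∀ N : ℕ, Tendsto (fun M : ℕ => torusRowPair β N M k) atTop
      (𝓝 (limUnder atTop fun M : ℕ => torusRowPair β N M k)) :=
    fun N => tendsto_nhds_limUnder (tendsto_torusRowPair_inner hβ N k)
  rcases Nat.eq_zero_or_pos k with rfl | hk
  · -- `k = 0`: everything is `1`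
    have h0 : (![((0 : ℕ) : ℤ), 0] : Site 2) = 0 := by
      rw [funext_iff, Fin.forall_fin_two]; simp
    rw [h0, twoPointPlus_zero]
    refine tendsto_const_nhds.congr' ?_
    filter_upwards [eventually_gt_atTop 0] with N hN
    refine (Tendsto.limUnder_eq ?_).symm
    refine tendsto_const_nhds.congr' ?_
    filter_upwards [eventually_gt_atTop 0] with M hM
    exact (torusRowPair_zero hN hM).symm
  · have hk0 : (![(k : ℤ), 0] : Site 2) ≠ 0 := vec_ne_zero_of_ne_zero (by omega)
    -- the free and plus box correlations both converge to the common value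
    have hfree : Tendsto (fun L : ℕ => isingCorr (zdGraph 2) (box 2 L) β 0 .free {0, ![(k : ℤ), 0]})
        atTop (𝓝 (twoPointPlus 2 β ![(k : ℤ), 0])) := by
      rw [← heq, twoPointFree_eq_freeCorr β hk0]
      exact hasBoxLimit_isingCorr_free_holds hβ le_rfl {0, ![(k : ℤ), 0]}
    have hplus : Tendsto (fun L : ℕ => isingCorr (zdGraph 2) (box 2 L) β 0 .plus {0, ![(k : ℤ), 0]})
        atTop (𝓝 (twoPointPlus 2 β ![(k : ℤ), 0])) := by
      rw [twoPointPlus_eq_plusCorr β hk0]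
      exact hasBoxLimit_isingCorr_plus_holds hβ le_rfl {0, ![(k : ℤ), 0]}
    rw [tendsto_order]
    constructor
    · intro b hb
      obtain ⟨L, hLb, hLk⟩ :=
        ((hfree.eventually (lt_mem_nhds hb)).and (eventually_ge_atTop k)).exists
      filter_upwards [eventually_ge_atTop (2 * L + 3)] with N hN
      refine hLb.trans_le (ge_of_tendsto (hinner N) ?_)
      filter_upwards [eventually_ge_atTop (2 * L + 3)] with M hM
      exact isingCorr_free_box_le_torusRowPair hβ hN hM hk hLk
    · intro b hb
      obtain ⟨L, hLb, hLk⟩ :=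
        ((hplus.eventually (gt_mem_nhds hb)).and (eventually_ge_atTop k)).exists
      filter_upwards [eventually_ge_atTop (2 * L + 3)] with N hN
      refine (le_of_tendsto (hinner N) ?_).trans_lt hLb
      filter_upwards [eventually_ge_atTop (2 * L + 3)] with M hM
      exact torusRowPair_le_isingCorr_plus_box hβ hN hM hk hLk

/-- **BGJS (3.1), periodic = plus**: where the free and plus two-point functions agree (`β ≥ 0`),
the iterated periodic limit equals them, `(σ_{(0,0)}σ_{(k,0)})_p(β) = ⟨σ₀σ_{(k,0)}⟩⁺_β`
(Benettin–Gallavotti–Jona-Lasinio–Stella, CMP 30 (1973), eq. (3.1): "`⟨σ_xσ_y⟩_a = ⟨σ_xσ_y⟩_p =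
⟨σ_xσ_y⟩_+`"). [cite: BenettinGallavottiJonaLasinioStella1973, §3, eq. (3.1)] -/
theorem torusRowPairLimit_eq_twoPointPlus_of_twoPointFree_eq_twoPointPlus {β : ℝ} (hβ : 0 ≤ β)
    {k : ℕ} (heq : twoPointFree 2 β ![(k : ℤ), 0] = twoPointPlus 2 β ![(k : ℤ), 0]) :
    torusRowPairLimit β k = twoPointPlus 2 β ![(k : ℤ), 0] :=
  (tendsto_torusRowPair_outer_of_twoPointFree_eq_twoPointPlus hβ heq).limUnder_eq

/-- **BGJS (3.3) from boundary-condition independence along the row**: if for every `β ≥ 0` and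
`k` the free and plus two-point functions agree at `(k, 0)`, the iterated periodic limits exist
(inner limits by the transfer matrix, outer limits by the squeeze). [cite: BenettinGallavottiJonaLasinioStella1973, §3 b), eq. (3.3)] -/
theorem tendsto_torusRowPair_exists_of_twoPointFree_eq_twoPointPlus
    (h : ∀ ⦃β : ℝ⦄, 0 ≤ β → ∀ k : ℕ, twoPointFree 2 β ![(k : ℤ), 0] = twoPointPlus 2 β ![(k : ℤ), 0]) :
    tendsto_torusRowPair_exists := fun _ hβ k =>
  ⟨fun N => tendsto_torusRowPair_inner hβ N k, _,
    tendsto_torusRowPair_outer_of_twoPointFree_eq_twoPointPlus hβ (h hβ k)⟩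

/-- **BGJS (3.7) from boundary-condition independence along the row**: under the same hypothesis
the Griffiths sandwich `⟨σσ⟩^∅ ≤ (σσ)_p ≤ ⟨σσ⟩⁺` holds for all `β ≥ 0` and `k`
(`torusRowPairLimit_sandwich_at` with the outer limit of the squeeze). [cite: BenettinGallavottiJonaLasinioStella1973, eq. (3.7)] -/
theorem torusRowPairLimit_sandwich_of_twoPointFree_eq_twoPointPlus
    (h : ∀ ⦃β : ℝ⦄, 0 ≤ β → ∀ k : ℕ, twoPointFree 2 β ![(k : ℤ), 0] = twoPointPlus 2 β ![(k : ℤ), 0]) :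
    torusRowPairLimit_sandwich := fun _ hβ k =>
  torusRowPairLimit_sandwich_at hβ (tendsto_torusRowPair_outer_of_twoPointFree_eq_twoPointPlus hβ (h hβ k))

/-! ### Boundary-condition independence from the vanishing of `m*` on `[0, β_c(2)]` -/

/-- **BGJS (3.1), free = plus, at every temperature** (Benettin–Gallavotti–Jona-Lasinio–Stella,
CMP 30 (1973), §3: below `β_c` by d) = Lebowitz–Martin-Löf 1972, above `β_c` by the duality
(2.3)–(2.4), eq. (3.10)). If `m*(β') = 0` for all `0 ≤ β' ≤ β_c(2)`, then for every `β ≥ 0` and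
`x ∈ ℤ²`, `⟨σ₀σ_x⟩^∅_{β,0} = ⟨σ₀σ_x⟩⁺_{β,0}`: for `β ≤ β_c(2)` by the Lebowitz–Martin-Löf criterion
(`twoPointFree_eq_twoPointPlus_of_spontaneousMagnetization_eq_zero`), for `β > β_c(2)` by duality at
`0 < β* < β_c(2)` (`twoPointFree_eq_twoPointPlus_of_spontaneousMagnetization_dualBeta_eq_zero`). [cite: BenettinGallavottiJonaLasinioStella1973, §3, eqs. (3.1) and (3.10)] -/
theorem twoPointFree_eq_twoPointPlus_of_spontaneousMagnetization_eq_zero_on_Iic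
    (hm : ∀ ⦃β : ℝ⦄, 0 ≤ β → β ≤ criticalBetaTwo → spontaneousMagnetization 2 β = 0)
    {β : ℝ} (hβ : 0 ≤ β) (x : Site 2) : twoPointFree 2 β x = twoPointPlus 2 β x := by
  rcases le_or_gt β criticalBetaTwo with hle | hgt
  · exact twoPointFree_eq_twoPointPlus_of_spontaneousMagnetization_eq_zero hβ (hm hβ hle) x
  · have hβ0 : 0 < β := criticalBetaTwo_pos.trans hgt
    exact twoPointFree_eq_twoPointPlus_of_spontaneousMagnetization_dualBeta_eq_zero hβ0
      (hm (dualBeta_pos hβ0).le (dualBeta_lt_criticalBetaTwo hgt).le) x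

/-- `onsager_yang` gives `m*(β) = m_O(β) = 0` for `0 ≤ β ≤ β_c(2)` (BGJS eq. (1.1)). [cite: BenettinGallavottiJonaLasinioStella1973, eq. (1.1)] -/
theorem spontaneousMagnetization_eq_zero_of_onsager_yang_of_le (h : onsager_yang) {β : ℝ}
    (hβ : 0 ≤ β) (hle : β ≤ criticalBetaTwo) : spontaneousMagnetization 2 β = 0 := by
  rw [onsager_yang_iff] at h
  rw [h β hβ, onsagerYangMagnetization_of_le hle]

/-- `criticalBeta_two` (`β_c(2) = inf {β ≥ 0 | m*(β) > 0} = ½ log(1+√2)`, BGJS c)) and continuity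
of the magnetisation at `β_c(2)` give `m*(β) = 0` for `0 ≤ β ≤ β_c(2)`. [cite: BenettinGallavottiJonaLasinioStella1973, §3 c)] -/
theorem spontaneousMagnetization_eq_zero_of_criticalBeta_two_of_le (hβc : criticalBeta_two)
    (hcrit : spontaneousMagnetization 2 criticalBetaTwo = 0) {β : ℝ} (hβ : 0 ≤ β)
    (hle : β ≤ criticalBetaTwo) : spontaneousMagnetization 2 β = 0 := by
  rcases hle.lt_or_eq with hlt | rfl
  · exact spontaneousMagnetization_two_eq_zero_of_lt_criticalBetaTwo hβc
      spontaneousMagnetization_nonneg_holds hβ hlt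
  · exact hcrit

/-! ### Reductions of BGJS (3.3) and (3.7) -/

/-- **BGJS (3.3) from `onsager_yang`**: the Onsager–Yang formula (with GKS, the transfer matrix,
the Lebowitz–Martin-Löf criterion and Kramers–Wannier duality, all theorems of the tree) implies
the existence of the iterated periodic limits for all `β ≥ 0`. [cite: BenettinGallavottiJonaLasinioStella1973, §3 b), eq. (3.3)] -/
theorem tendsto_torusRowPair_exists_of_onsager_yang (h : onsager_yang) : tendsto_torusRowPair_exists :=
  tendsto_torusRowPair_exists_of_twoPointFree_eq_twoPointPlus fun _ hβ _ =>
    twoPointFree_eq_twoPointPlus_of_spontaneousMagnetization_eq_zero_on_Iic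
      (fun _ hβ' hle => spontaneousMagnetization_eq_zero_of_onsager_yang_of_le h hβ' hle) hβ _

/-- **BGJS (3.7) from `onsager_yang`**: the named fact `torusRowPairLimit_sandwich` follows from the
Onsager–Yang formula. [cite: BenettinGallavottiJonaLasinioStella1973, eq. (3.7)] -/
theorem torusRowPairLimit_sandwich_of_onsager_yang (h : onsager_yang) : torusRowPairLimit_sandwich :=
  torusRowPairLimit_sandwich_of_twoPointFree_eq_twoPointPlus fun _ hβ _ =>
    twoPointFree_eq_twoPointPlus_of_spontaneousMagnetization_eq_zero_on_Iic
      (fun _ hβ' hle => spontaneousMagnetization_eq_zero_of_onsager_yang_of_le h hβ' hle) hβ _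

/-- **BGJS (3.1) in full from `onsager_yang`**: for all `β ≥ 0` and `k`,
`⟨σ₀σ_{(k,0)}⟩^∅_β = (σ_{(0,0)}σ_{(k,0)})_p(β) = ⟨σ₀σ_{(k,0)}⟩⁺_β` ("`⟨σ_xσ_y⟩_a = ⟨σ_xσ_y⟩_p = ⟨σ_xσ_y⟩_+`",
Benettin–Gallavotti–Jona-Lasinio–Stella, CMP 30 (1973), eq. (3.1)). [cite: BenettinGallavottiJonaLasinioStella1973, §3, eq. (3.1)] -/
theorem twoPointFree_eq_torusRowPairLimit_of_onsager_yang (h : onsager_yang) {β : ℝ} (hβ : 0 ≤ β)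
    (k : ℕ) :
    twoPointFree 2 β ![(k : ℤ), 0] = torusRowPairLimit β k ∧
      torusRowPairLimit β k = twoPointPlus 2 β ![(k : ℤ), 0] := by
  have heq : twoPointFree 2 β ![(k : ℤ), 0] = twoPointPlus 2 β ![(k : ℤ), 0] :=
    twoPointFree_eq_twoPointPlus_of_spontaneousMagnetization_eq_zero_on_Iic
      (fun _ hβ' hle => spontaneousMagnetization_eq_zero_of_onsager_yang_of_le h hβ' hle) hβ _
  have hp := torusRowPairLimit_eq_twoPointPlus_of_twoPointFree_eq_twoPointPlus hβ heq
  exact ⟨heq.trans hp.symm, hp⟩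

/-- **BGJS (3.3) from the critical point and continuity at `β_c(2)`**: `criticalBeta_two` and
`m*(β_c(2)) = 0` imply the existence of the iterated periodic limits for all `β ≥ 0`. [cite: BenettinGallavottiJonaLasinioStella1973, §3 b), eq. (3.3)] -/
theorem tendsto_torusRowPair_exists_of_criticalBeta_two (hβc : criticalBeta_two)
    (hcrit : spontaneousMagnetization 2 criticalBetaTwo = 0) : tendsto_torusRowPair_exists :=
  tendsto_torusRowPair_exists_of_twoPointFree_eq_twoPointPlus fun _ hβ _ =>
    twoPointFree_eq_twoPointPlus_of_spontaneousMagnetization_eq_zero_on_Iic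
      (fun _ hβ' hle => spontaneousMagnetization_eq_zero_of_criticalBeta_two_of_le hβc hcrit hβ' hle)
      hβ _

/-- **BGJS (3.7) from the critical point and continuity at `β_c(2)`**. [cite: BenettinGallavottiJonaLasinioStella1973, eq. (3.7)] -/
theorem torusRowPairLimit_sandwich_of_criticalBeta_two (hβc : criticalBeta_two)
    (hcrit : spontaneousMagnetization 2 criticalBetaTwo = 0) : torusRowPairLimit_sandwich :=
  torusRowPairLimit_sandwich_of_twoPointFree_eq_twoPointPlus fun _ hβ _ =>
    twoPointFree_eq_twoPointPlus_of_spontaneousMagnetization_eq_zero_on_Iic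
      (fun _ hβ' hle => spontaneousMagnetization_eq_zero_of_criticalBeta_two_of_le hβc hcrit hβ' hle)
      hβ _

/-- **The outer limit of BGJS (3.3) from the Toeplitz identity and continuity at `β_c(2)`**: for
every `β ≥ 0` and `k` the outer limit `N → ∞` exists — at `β = 0` (`m*(0) = 0`) and `β = β_c(2)`
(`m*(β_c(2)) = 0`) by boundary-condition independence and the squeeze, at `β > 0`, `β ≠ β_c(2)` by
the Montroll–Potts–Ward / Schultz–Mattis–Lieb identity `torusRowPair_tendsto_toeplitzDet`. [cite: BenettinGallavottiJonaLasinioStella1973, §3 b), eq. (3.3)] -/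
theorem tendsto_torusRowPair_outer_of_toeplitzDet (hT : torusRowPair_tendsto_toeplitzDet)
    (hcrit : spontaneousMagnetization 2 criticalBetaTwo = 0) {β : ℝ} (hβ : 0 ≤ β) (k : ℕ) :
    ∃ ρ : ℝ, Tendsto (fun N : ℕ => limUnder atTop fun M : ℕ => torusRowPair β N M k) atTop (𝓝 ρ) := by
  rcases hβ.eq_or_lt with h0 | hpos
  · subst h0
    exact ⟨_, tendsto_torusRowPair_outer_of_twoPointFree_eq_twoPointPlus le_rfl
      (twoPointFree_eq_twoPointPlus_of_spontaneousMagnetization_eq_zero le_rfl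
        (spontaneousMagnetization_zero 2) _)⟩
  · by_cases hc : β = criticalBetaTwo
    · subst hc
      exact ⟨_, tendsto_torusRowPair_outer_of_twoPointFree_eq_twoPointPlus hβ
        (twoPointFree_eq_twoPointPlus_of_spontaneousMagnetization_eq_zero hβ hcrit _)⟩
    · exact ⟨_, tendsto_torusRowPair_outer_of_toeplitz hT hpos hc k⟩

/-- **BGJS (3.3) from the Toeplitz identity and continuity at `β_c(2)`** (inner limits by the
transfer matrix). [cite: BenettinGallavottiJonaLasinioStella1973, §3 b), eq. (3.3)] -/
theorem tendsto_torusRowPair_exists_of_toeplitzDet (hT : torusRowPair_tendsto_toeplitzDet)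
    (hcrit : spontaneousMagnetization 2 criticalBetaTwo = 0) : tendsto_torusRowPair_exists :=
  fun _ hβ k =>
    ⟨fun N => tendsto_torusRowPair_inner hβ N k, tendsto_torusRowPair_outer_of_toeplitzDet hT hcrit hβ k⟩

/-- **BGJS (3.7) from the Toeplitz identity and continuity at `β_c(2)`**. [cite: BenettinGallavottiJonaLasinioStella1973, eq. (3.7)] -/
theorem torusRowPairLimit_sandwich_of_toeplitzDet (hT : torusRowPair_tendsto_toeplitzDet)
    (hcrit : spontaneousMagnetization 2 criticalBetaTwo = 0) : torusRowPairLimit_sandwich := by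
  intro β hβ k
  obtain ⟨ρ, hρ⟩ := tendsto_torusRowPair_outer_of_toeplitzDet hT hcrit hβ k
  exact torusRowPairLimit_sandwich_at hβ hρ

/-- **BGJS (3.3) from the Toeplitz form of the exact solution** (the three named facts of
`OnsagerToeplitz.onsager_yang_of_toeplitz`: the Toeplitz identity, the strong Szegő limit theorem,
Wu's decay), through `onsager_yang`. [cite: BenettinGallavottiJonaLasinioStella1973, §3 b), eq. (3.3)] -/
theorem tendsto_torusRowPair_exists_of_toeplitz (hT : torusRowPair_tendsto_toeplitzDet)
    (hSz : strongSzego) (hWu : toeplitzDet_onsagerSymbol_exp_decay) : tendsto_torusRowPair_exists :=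
  tendsto_torusRowPair_exists_of_onsager_yang (onsager_yang_of_toeplitz hT hSz hWu)

/-- **BGJS (3.7) from the Toeplitz form of the exact solution**: the named fact
`torusRowPairLimit_sandwich` follows from the three Toeplitz facts of `OnsagerToeplitz.lean`. [cite: BenettinGallavottiJonaLasinioStella1973, eq. (3.7)] -/
theorem torusRowPairLimit_sandwich_of_toeplitz (hT : torusRowPair_tendsto_toeplitzDet)
    (hSz : strongSzego) (hWu : toeplitzDet_onsagerSymbol_exp_decay) : torusRowPairLimit_sandwich :=
  torusRowPairLimit_sandwich_of_onsager_yang (onsager_yang_of_toeplitz hT hSz hWu)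

end Literature.Probability.LatticeModels
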